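import Summits.ABC.ABC.Statement
import Summits.ABC.ABC.Theorems.SoloBlindTwoPrimes
import Literature.NumberTheory.DiophantineGeometry.AbcWave0MihailescuProofs
import Literature.NumberTheory.DiophantineGeometry.AbcWave0QualityFormProofs
import HarnessLib

/-!
# The prime-square corner of the first open support is a theorem (solo-ABC-blind, generation 5)

On the first open support `{2, p, q}` of the abc conjecture (`ω(abc) = 3`, see
`SoloBlindTwoPrimes`, `SoloBlindOmegaFree`) consider the shape `1 + b = q²` with `q` prime, i.e. the
triples `(1, q² - 1, q²)` whose product has at most three prime factors.  Writing
`q² - 1 = (q-1)(q+1)` with `gcd = 2`, the support condition forces `{q-1, q+1} = {2^α, 2p^δ}`, hence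
`p^δ = 2^(α-1) ± 1`, and **Mihăilescu's theorem** (a theorem of the Literature library,
`mihailescu_holds`) leaves `δ = 1` or the sporadic `1 + 288 = 289 = 17²` (`9 = 8 + 1`).  Consequently

* `sq_corner` : for every prime `q` and `b + 1 = q²` with `#(b·q²).primeFactors ≤ 3`,
  `102 · q² ≤ 289 · rad(1, b, q²)`, with equality exactly at the sporadic triple (`sq_corner_sharp`);
  in particular `c < 3 · rad` on this corner (`sq_corner_lt`): abc with `(ε, C) = (0, 289/102)`.

So the `n = 2` corner of the shape `1 + 2^k p^m = qⁿ` is settled by the same mechanism (Catalan) that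
settles `ω ≤ 2`; the conjecture on `{2, p, q}` lives in the corners that are *not* differences of proper
powers equal to `1` (Nagell–Ljunggren-type and linear-forms territory).  Background: [Mihailescu2004];
nearest prior discussion of abc on supports `2^m pⁿ q^r` with Fermat/Mersenne primes: arXiv:1809.03328.
-/

open UniqueFactorizationMonoid Finset

namespace Summit.ABC.ABC.Theorems

open Literature.NumberTheory.DiophantineGeometry

/-- A natural number all of whose prime divisors equal `r` is a power of `r` (wrapper). -/
private theorem eq_pow_of_prime_dvd {n r : ℕ} (hn : n ≠ 0) (h : ∀ d : ℕ, d.Prime → d ∣ n → d = r) :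
    ∃ k : ℕ, n = r ^ k :=
  ⟨_, Nat.eq_prime_pow_of_unique_prime_dvd hn (fun hd hdn => h _ hd hdn)⟩


/-- **Core of the corner.** If `u ≥ 4` is even and every prime divisor of `u(u+2)` is `2` or the odd
prime `p`, then `2p = u + 2`, or `2p = u`, or `(u, p) = (16, 3)` (the Catalan case `9 = 8 + 1`).
[Mihailescu2004, Theorem 1] -/
theorem two_mul_eq_or_of_prime_support {u p : ℕ} (hu4 : 4 ≤ u) (hu : Even u) (hp : p.Prime)
    (hp2 : p ≠ 2) (hS : ∀ d : ℕ, d.Prime → d ∣ u * (u + 2) → d = 2 ∨ d = p) :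
    2 * p = u + 2 ∨ 2 * p = u ∨ (u = 16 ∧ p = 3) := by
  have hM : ∀ {x y a b : ℕ}, 0 < y → 2 ≤ a → 2 ≤ b → x ^ a = y ^ b + 1 →
      x = 3 ∧ a = 2 ∧ y = 2 ∧ b = 3 :=
    Literature.NumberTheory.DiophantineGeometry.mihailescu_holds
  have hp3 : 3 ≤ p := by have := hp.two_le; omega
  -- `4` does not divide both `u` and `u + 2`
  have h4 : ¬ (4 ∣ u ∧ 4 ∣ u + 2) := by
    rintro ⟨h1, h2⟩
    have : 4 ∣ 2 := (Nat.dvd_add_right h1).mp h2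
    exact absurd (Nat.le_of_dvd (by norm_num) this) (by norm_num)
  by_cases hpu : p ∣ u
  · -- `p ∣ u`: then `p ∤ u + 2`, so `u + 2` is a power of `2` and `u = 2·p^β`
    have hpw : ¬ p ∣ u + 2 := by
      intro h
      have : p ∣ 2 := (Nat.dvd_add_right hpu).mp h
      exact hp2 ((Nat.prime_dvd_prime_iff_eq hp Nat.prime_two).mp this)
    obtain ⟨γ, hγ⟩ : ∃ γ : ℕ, u + 2 = 2 ^ γ := by
      refine ⟨_, Nat.eq_prime_pow_of_unique_prime_dvd (by omega) ?_⟩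
      intro d hd hdw
      rcases hS d hd (hdw.mul_left u) with h | h
      · exact h
      · exact absurd (h ▸ hdw) hpw
    obtain ⟨α, y, hy, huy⟩ := Nat.exists_eq_two_pow_mul_odd (n := u) (by omega)
    -- `γ ≥ 3` since `u + 2 ≥ 6` is a power of two; hence `4 ∣ u + 2` and `α = 1`
    have hγ3 : 3 ≤ γ := by
      by_contra hlt
      have : 2 ^ γ ≤ 2 ^ 2 := Nat.pow_le_pow_right (by norm_num) (by omega)
      omega
    have h4w : 4 ∣ u + 2 := by
      have : 2 ^ 2 ∣ 2 ^ γ := pow_dvd_pow 2 (by omega)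
      rw [hγ]; simpa using this
    have hα1 : α = 1 := by
      rcases Nat.lt_or_ge α 2 with h | h
      · rcases Nat.lt_or_ge α 1 with h0 | h1
        · obtain rfl : α = 0 := by omega
          rw [pow_zero, one_mul] at huy
          exact absurd (huy ▸ hu) (Nat.not_even_iff_odd.mpr hy)
        · omega
      · exfalso
        refine h4 ⟨?_, h4w⟩
        have : 2 ^ 2 ∣ 2 ^ α * y := (pow_dvd_pow 2 h).mul_right y
        rw [huy]; simpa using this
    rw [hα1, pow_one] at huy
    -- `y` is a power of `p`
    have hy0 : y ≠ 0 := by rintro rfl; omega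
    obtain ⟨β, hβ⟩ : ∃ β : ℕ, y = p ^ β := by
      refine eq_pow_of_prime_dvd hy0 ?_
      intro d hd hdy
      have hdu : d ∣ u := huy ▸ hdy.mul_left 2
      rcases hS d hd (hdu.mul_right _) with h | h
      · exfalso
        rw [h] at hdy
        exact (Nat.not_even_iff_odd.mpr hy) (even_iff_two_dvd.mpr hdy)
      · exact h
    rw [hβ] at huy
    -- `2 ^ γ = 2 p^β + 2`
    rcases Nat.lt_or_ge β 2 with hβ1 | hβ2
    · rcases Nat.lt_or_ge β 1 with hβ0 | hβ1'
      · obtain rfl : β = 0 := by omega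
        rw [pow_zero] at huy; omega
      · obtain rfl : β = 1 := by omega
        rw [pow_one] at huy
        exact Or.inr (Or.inl huy.symm)
    · -- Mihăilescu: `2 ^ (γ-1) = p ^ β + 1` is impossible
      exfalso
      have hpow : 2 ^ γ = 2 * 2 ^ (γ - 1) := by
        rw [← pow_succ', Nat.sub_add_cancel (by omega : 1 ≤ γ)]
      have heq : 2 ^ (γ - 1) = p ^ β + 1 := by omega
      have := (hM hp.pos (by omega) hβ2 heq).1
      omega
  · -- `p ∤ u`: then `u` is a power of `2` and `u + 2 = 2·p^δ`
    obtain ⟨α, hα⟩ : ∃ α : ℕ, u = 2 ^ α := by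
      refine ⟨_, Nat.eq_prime_pow_of_unique_prime_dvd (by omega) ?_⟩
      intro d hd hdu
      rcases hS d hd (hdu.mul_right _) with h | h
      · exact h
      · exact absurd (h ▸ hdu) hpu
    have hα2 : 2 ≤ α := by
      by_contra hlt
      have : 2 ^ α ≤ 2 ^ 1 := Nat.pow_le_pow_right (by norm_num) (by omega)
      omega
    have h4u : 4 ∣ u := by
      have : 2 ^ 2 ∣ 2 ^ α := pow_dvd_pow 2 hα2
      rw [hα]; simpa using this
    obtain ⟨γ, y, hy, hwy⟩ := Nat.exists_eq_two_pow_mul_odd (n := u + 2) (by omega)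
    have hγ1 : γ = 1 := by
      rcases Nat.lt_or_ge γ 2 with h | h
      · rcases Nat.lt_or_ge γ 1 with h0 | h1
        · obtain rfl : γ = 0 := by omega
          rw [pow_zero, one_mul] at hwy
          have : Even (u + 2) := by rcases hu with ⟨k, hk⟩; exact ⟨k + 1, by omega⟩
          exact absurd (hwy ▸ this) (Nat.not_even_iff_odd.mpr hy)
        · omega
      · exfalso
        refine h4 ⟨h4u, ?_⟩
        have : 2 ^ 2 ∣ 2 ^ γ * y := (pow_dvd_pow 2 h).mul_right y
        rw [hwy]; simpa using this
    rw [hγ1, pow_one] at hwy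
    have hy0 : y ≠ 0 := by rintro rfl; omega
    obtain ⟨δ, hδ⟩ : ∃ δ : ℕ, y = p ^ δ := by
      refine eq_pow_of_prime_dvd hy0 ?_
      intro d hd hdy
      have hdw : d ∣ u + 2 := hwy ▸ hdy.mul_left 2
      rcases hS d hd (hdw.mul_left _) with h | h
      · exfalso
        rw [h] at hdy
        exact (Nat.not_even_iff_odd.mpr hy) (even_iff_two_dvd.mpr hdy)
      · exact h
    rw [hδ] at hwy
    -- `2 p^δ = 2^α + 2`
    rcases Nat.lt_or_ge δ 2 with hδ1 | hδ2
    · rcases Nat.lt_or_ge δ 1 with hδ0 | hδ1'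
      · obtain rfl : δ = 0 := by omega
        rw [pow_zero] at hwy; omega
      · obtain rfl : δ = 1 := by omega
        rw [pow_one] at hwy
        exact Or.inl hwy.symm
    · rcases Nat.lt_or_ge α 3 with hα3 | hα3
      · -- `α = 2`: `p^δ = 3`, impossible for `δ ≥ 2`
        exfalso
        obtain rfl : α = 2 := by omega
        have h9 : 3 ^ 2 ≤ p ^ δ :=
          le_trans (Nat.pow_le_pow_left hp3 2) (Nat.pow_le_pow_right hp.pos hδ2)
        norm_num at hwy h9
        omega
      · -- Mihăilescu: `p^δ = 2^(α-1) + 1` forces `(p, δ, α) = (3, 2, 4)`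
        have hpow : 2 ^ α = 2 * 2 ^ (α - 1) := by
          rw [← pow_succ', Nat.sub_add_cancel (by omega : 1 ≤ α)]
        have heq : p ^ δ = 2 ^ (α - 1) + 1 := by omega
        obtain ⟨rfl, -, -, h3⟩ := hM (by norm_num : 0 < 2) hδ2 (by omega) heq
        have hα4 : α = 4 := by omega
        subst hα4
        refine Or.inr (Or.inr ⟨by rw [hα]; norm_num, rfl⟩)


/-- **abc on the prime-square corner, sharp form.** For a prime `q` and `b + 1 = q²` with
`#(1·b·q²).primeFactors ≤ 3`: `102·q² ≤ 289·rad(1, b, q²)` (equality at `1 + 288 = 17²`,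
`sq_corner_sharp`). Inputs: `two_mul_eq_or_of_prime_support` (Mihăilescu) and `rad = 2pq`.
[Mihailescu2004, Theorem 1] -/
theorem sq_corner {b q : ℕ} (hq : q.Prime) (hbq : b + 1 = q ^ 2)
    (hω : (1 * b * q ^ 2).primeFactors.card ≤ 3) : 102 * q ^ 2 ≤ 289 * rad 1 b (q ^ 2) := by
  have hq2 := hq.two_le
  have hqsq : 4 ≤ q ^ 2 := by nlinarith
  have hb0 : b ≠ 0 := by omega
  have ht : IsABCTriple 1 b (q ^ 2) := ⟨by norm_num, by omega, by omega, Nat.coprime_one_left b⟩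
  rcases Nat.lt_or_ge q 3 with hq3 | hq3
  · -- `q = 2`, `b = 3`: `rad ≥ 2` suffices
    obtain rfl : q = 2 := by omega
    have := ht.two_le_rad
    norm_num at this ⊢
    omega
  rcases Nat.lt_or_ge q 5 with hq5 | hq5
  · -- `q = 3`, `b = 8`: `rad(1·8·9) = 6`
    have h34 : q = 3 ∨ q = 4 := by omega
    rcases h34 with rfl | rfl
    · obtain rfl : b = 8 := by omega
      have h := card_le_two_sharp.2.2
      norm_num at h ⊢
      omega
    · exact absurd hq (by decide)
  -- `q ≥ 5`: write `q = u + 1`, `b = u (u + 2)`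
  obtain ⟨u, rfl⟩ : ∃ u, q = u + 1 := ⟨q - 1, by omega⟩
  have hu4 : 4 ≤ u := by omega
  have hqodd : Odd (u + 1) := hq.odd_of_ne_two (by omega)
  have hu : Even u := by
    rcases hqodd with ⟨k, hk⟩
    exact ⟨k, by omega⟩
  have hb : b = u * (u + 2) := by
    have h := hbq
    ring_nf at h ⊢
    linarith
  have h2b : 2 ∈ b.primeFactors :=
    Nat.mem_primeFactors.mpr ⟨Nat.prime_two, by rw [hb]; exact (even_iff_two_dvd.mp hu).mul_right _, hb0⟩
  -- `b` has at most two prime factors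
  have hcop : Nat.Coprime b ((u + 1) ^ 2) := by
    rw [← hbq]; exact Nat.coprime_self_add_right.mpr (Nat.coprime_one_right b)
  have hq0 : (u + 1) ^ 2 ≠ 0 := by positivity
  have hcard : b.primeFactors.card ≤ 2 := by
    have hsub : b.primeFactors ⊆ (1 * b * (u + 1) ^ 2).primeFactors := by
      rw [one_mul]; exact Nat.primeFactors_mono (dvd_mul_right b _) (mul_ne_zero hb0 hq0)
    have hqmem : u + 1 ∈ (1 * b * (u + 1) ^ 2).primeFactors := by
      rw [one_mul]
      exact Nat.mem_primeFactors.mpr ⟨hq, (dvd_pow_self (u + 1) two_ne_zero).mul_left b,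
        mul_ne_zero hb0 hq0⟩
    have hqnot : u + 1 ∉ b.primeFactors := by
      intro hmem
      have hdvd := (Nat.mem_primeFactors.mp hmem).2.1
      have h1 : u + 1 ∣ 1 := by
        have : u + 1 ∣ b + 1 := by rw [hbq]; exact dvd_pow_self (u + 1) two_ne_zero
        exact (Nat.dvd_add_right hdvd).mp this
      exact absurd (Nat.le_of_dvd one_pos h1) (by omega)
    have hne : b.primeFactors ≠ (1 * b * (u + 1) ^ 2).primeFactors := by
      intro h; rw [h] at hqnot; exact hqnot hqmem
    have hlt := Finset.card_lt_card (lt_of_le_of_ne hsub hne)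
    omega
  -- an odd prime `p` with `supp(b) ⊆ {2, p}`
  obtain ⟨p, hp, hp2, hS⟩ : ∃ p, p.Prime ∧ p ≠ 2 ∧ ∀ d, d.Prime → d ∣ b → d = 2 ∨ d = p := by
    by_cases hall : ∀ d ∈ b.primeFactors, d = 2
    · exact ⟨3, Nat.prime_three, by norm_num,
        fun d hd hdb => Or.inl (hall d (Nat.mem_primeFactors.mpr ⟨hd, hdb, hb0⟩))⟩
    · push Not at hall
      obtain ⟨p, hpmem, hp2⟩ := hall
      have hp := (Nat.mem_primeFactors.mp hpmem).1
      refine ⟨p, hp, hp2, fun d hd hdb => ?_⟩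
      by_contra hne
      push Not at hne
      have hdmem : d ∈ b.primeFactors := Nat.mem_primeFactors.mpr ⟨hd, hdb, hb0⟩
      have h3 : ({2, p, d} : Finset ℕ).card = 3 :=
        Finset.card_eq_three.mpr ⟨2, p, d, hp2.symm, hne.1.symm, hne.2.symm, rfl⟩
      have hsub3 : ({2, p, d} : Finset ℕ) ⊆ b.primeFactors := by
        intro x hx
        simp only [Finset.mem_insert, Finset.mem_singleton] at hx
        rcases hx with rfl | rfl | rfl
        exacts [h2b, hpmem, hdmem]
      have := Finset.card_le_card hsub3
      omega
  have hcore := two_mul_eq_or_of_prime_support hu4 hu hp hp2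
    (fun d hd hdvd => hS d hd (by rw [hb]; exact hdvd))
  -- in every case `p ∣ b`, so `supp(b) = {2, p}` and `rad = 2 p q`
  have hpb : p ∣ b := by
    rcases hcore with h1 | h2 | ⟨h16, h3⟩
    · rw [hb]; exact (Dvd.intro_left 2 h1).mul_left u
    · rw [hb]; exact (Dvd.intro_left 2 h2).mul_right (u + 2)
    · subst h16; subst h3; rw [hb]; norm_num
  have hpf : b.primeFactors = {2, p} := by
    apply Finset.Subset.antisymm
    · intro d hd
      have hd' := Nat.mem_primeFactors.mp hd
      rcases hS d hd'.1 hd'.2.1 with h | h <;> simp [h]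
    · intro d hd
      simp only [Finset.mem_insert, Finset.mem_singleton] at hd
      rcases hd with rfl | rfl
      · exact h2b
      · exact Nat.mem_primeFactors.mpr ⟨hp, hpb, hb0⟩
  have hrad : rad 1 b ((u + 1) ^ 2) = 2 * p * (u + 1) := by
    have hradb : radical b = 2 * p := by
      rw [Nat.radical_eq_prod_primeFactors, hpf, Finset.prod_pair hp2.symm]
    have hradq : radical ((u + 1) ^ 2) = u + 1 := by
      rw [radical_pow _ two_ne_zero, Nat.radical_eq_prod_primeFactors, hq.primeFactors,
        Finset.prod_singleton]
    rw [rad_def, one_mul, radical_mul (Nat.coprime_iff_isRelPrime.mp hcop), hradb, hradq]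
  rw [hrad]
  rcases hcore with h1 | h2 | ⟨h16, h3⟩
  · have : 2 * p * (u + 1) = (u + 2) * (u + 1) := by rw [h1]
    rw [this]; nlinarith
  · have : 2 * p * (u + 1) = u * (u + 1) := by rw [h2]
    rw [this]; nlinarith
  · subst h16; subst h3; norm_num

/-- **Sharpness:** the sporadic triple `1 + 288 = 289 = 17²` (`288 = 2⁵·3²`, three primes, `rad = 102`)
gives equality in `sq_corner`. [folklore] -/
theorem sq_corner_sharp : IsABCTriple 1 288 289 ∧ Nat.Prime 17 ∧ 288 + 1 = 17 ^ 2 ∧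
    (1 * 288 * 17 ^ 2).primeFactors.card = 3 ∧ 102 * 17 ^ 2 = 289 * rad 1 288 (17 ^ 2) := by
  have hpf : (1 * 288 * 17 ^ 2 : ℕ).primeFactors = {2, 3, 17} := by
    rw [show (1 * 288 * 17 ^ 2 : ℕ) = (2 ^ 5 * 3 ^ 2) * 17 ^ 2 by norm_num,
      Nat.primeFactors_mul (by norm_num) (by norm_num), Nat.primeFactors_mul (by norm_num) (by norm_num),
      Nat.primeFactors_prime_pow (by norm_num) Nat.prime_two,
      Nat.primeFactors_prime_pow (by norm_num) Nat.prime_three,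
      Nat.primeFactors_prime_pow (by norm_num) (by norm_num : Nat.Prime 17)]
    decide
  refine ⟨⟨by norm_num, by norm_num, by norm_num, by decide⟩, by norm_num, by norm_num,
    by rw [hpf]; decide, ?_⟩
  rw [rad_def, Nat.radical_eq_prod_primeFactors, hpf]
  decide

/-- **Corollary:** `c < 3·rad(abc)` on the prime-square corner of the support `{2, p, q}` — the same
constant-`3` form that holds (with `3/2`) below three primes. [folklore] -/
theorem sq_corner_lt {b q : ℕ} (hq : q.Prime) (hbq : b + 1 = q ^ 2)
    (hω : (1 * b * q ^ 2).primeFactors.card ≤ 3) : q ^ 2 < 3 * rad 1 b (q ^ 2) := by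
  have h := sq_corner hq hbq hω
  have hq2 := hq.two_le
  have hqsq : 4 ≤ q ^ 2 := by nlinarith
  have ht : IsABCTriple 1 b (q ^ 2) := ⟨by norm_num, by omega, by omega, Nat.coprime_one_left b⟩
  have hr := ht.two_le_rad
  linarith

end Summit.ABC.ABC.Theorems
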